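import Literature.MathematicalPhysics.QuantumFieldTheory.Balaban1983to89.B8Prop5UniqueZdLan
import Literature.MathematicalPhysics.QuantumFieldTheory.Balaban1983to89.B8Prop5LandauDataZdPer
import Literature.MathematicalPhysics.QuantumFieldTheory.Balaban1983to89.B8SockP5uEBodyNestedPer

/-!
# `Balaban1983to89.B8Prop5UniqueZdLanPer` — [Balaban1985RegularSpaces] PROPOSITION 5, THE UNIQUENESS CLAUSE (1.109) p. 94, AS PRINTED, ON THE TORUS (§3 p. 98):
# `B8.Prop5Unique (fun a => zdLanPer L B₁ (ι a) (p a))` over any index map `ι` into the `Ω 0 = T_η` members and any period map `p`, MODULO [4]'s uniqueness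
# letters at every member with their laws AT PERIODIC ARGUMENTS — brick U3′ (second currency) of the interface request B8-P5-NESTED-SERVER (uniqueness half);
# the periodic twin of dag-n05-d's `B8Prop5UniqueZdLan.prop5Unique_zdLan_of_lettersUB`, torus-native (NOT the banked transfer `prop5Unique_per_of_zd`)

statement-level skeleton of published theorems with citation tags; proofs where landed; nothing here is a claim about the Yang–Mills mass gap

T. Bałaban, *Spaces of regular gauge field configurations on a lattice and gauge fixing conditions*, Commun. Math. Phys. **99** (1985) 75–102
`[Balaban1985RegularSpaces]` ("B8"; journal page = PDF page + 74): Prop. 5 (1.107)–(1.109) p. 94 [PDF 20] («There exist positive constants c₂, c₃, depending on d and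
L only … Such a configuration u′ is unique in the domain |λ|, |Dλ|₍₋₁₎ < c₃. (1.109)»), pp. 88–89 ((1.68)–(1.69), (1.73)–(1.74)), p. 89 (after (1.76): «(1.73), (1.74)
together with R₀ū₁ʲ = 1 on Λ_j imply that u₁ satisfies (166), (167) [3] on Bʲ(Λ_j)»), p. 93 (1.102), pp. 95–97 (Sect. E), p. 77 («Ω₀ ⊃ Ω₁ ⊃ … we admit the case
when some domains Ω_j are equal to T_η»), §3 p. 98.  [3] = [Balaban1985Averaging] ((166)–(167) p. 44, Prop. 10 p. 50, (4) p. 18: the torus `T_η` as `P`-periodic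
data on `ηℤᵈ`); [4] = [Balaban1985BackgroundPropagators] (Thm 3.1 p. 397, (3.24)–(3.25) p. 394, Thms 3.2–3.3 pp. 397–398).  PDF held:
`paper:balaban1985-cmp99-regular-spaces-gauge-fixing`.  STATUS: published, refereed.

CITATION HEADER (lean-in-tree rule).  Cell `lit-balaban`, seat `lit-balaban-p21` (gen 39), sub-row «G-B8-T2S» (R3 `stmt-QuantumFields-19200`, `--supports`, helper; the
consumers bear on `stmt-QuantumFields-27364`).  Interface request B8-P5-NESTED-SERVER, SECOND CURRENCY (pub-ymgap dag-n05-c g17 ADDENDUM l.41942, 2026-08-28;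
lit-balaban lead g33 answer pub-ymgap 18:25:09Z; `lit-balaban-p21/WAKE-B8P5NestedServerUniq.md` addendum 18:25:26Z): «serve the slot's own … `B8.Prop5Unique`
(same family `fun a : Node00.IdxB8LanCκPer θ P M₁ R => B8Prop5LandauDataZdPer.zdLanPer θ.L B₁ a.toZdLanIdx P`) … the same … uniqueness engine at the member's
top level read through those iff's; torus-native (NOT the BANKED `prop5Unique_per_of_zd`)».

WHAT THIS FILE PROVES (one theorem, no `def`).
★★★ `prop5Unique_zdLanPer_of_lettersAtPerNested` — dag-n05-d's `B8Prop5UniqueZdLan.prop5Unique_zdLan_of_lettersUB` VERBATIM on the PERIODIC sub-model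
`B8Prop5LandauDataZdPer.zdLanPer L B₁ (ι j) (p j)` (datum `(u₁, A)` and parameters `λ` periodic BY THE CARRIER; `Hyp169 ∕ Solves ∕ lamNorm` = `zdLan`'s at the
underlying fields, `Iff.rfl`), for every index map `ι : J → ZdLanIdx d 𝔸` and period map `p : J → ℕ` into members with `Ω 0 = ℤᵈ` (print's `Ω₀ = T_η` read on
`ηℤᵈ`), antitone `{Ω_j}`, towers `Bʲ(Λ_j) ⊂ Ω_j` AND the torus laws of the periodic (1.5)-index — the fixed background `U₀` `p j`-periodic, `Lᵏ ∣ p j`, every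
`Λ_n` invariant under the period shifts `+ (p j ∕ Lⁿ) • e ι` — GIVEN at every `ι j`, for every regularity `α₀ ≤ c_L` with `U₀ ∈ 𝔄_k({Ω_j}, α₀)`, [4]'s uniqueness
letters `g = G′, Δ, q = Q′, qs = Q′ᵀ, Aw = 𝔄, c = C, H′` at `(k, Λ, U₀)` with their laws AT PERIODIC ARGUMENTS (RULING #4 of sub-row «G-B8-T2S»: (U1) the left-inverse
law of `G′` at PERIODIC bounded functions, (U2) the left inverse of `C` at LEVEL-PERIODIC multipliers, (1.91) `Q′H′ = I` at LEVEL-PERIODIC families; (P)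
`G′` periodic-valued, `𝔄` level-periodic-valued, `H′` periodicity-preserving; readings, (1.92), (1.101), (1.98) as before) — print's uniqueness clause HOLDS on the
family: `∃ c₂ c₃ > 0` (`c₂ = min(c_P, c_L)`, `c₃ = c_u∕L`; `α₄, c_u, c_P` of `B8SockP5uEWindows.uniqWindows_of_guard` at `B₀ = max(B₁, 2)∕(5dL)`) such that at every
member, for `α₀ + α₁ ≤ c₂` and every PERIODIC datum with (1.33), (1.69), (1.68), (1.73)–(1.74), two PERIODIC parameters solving (1.107) in the `c₃`-domain
COINCIDE.  PROOF = the template's, token for token, with the uniqueness JOIN ON THE TORUS `B8Prop5UniqSectEWPer.hFP_unique_of_sectE_local_wb_per` (BY NAME) in place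
of `hFP_unique_of_sectE_local_wb`, fed additionally by: the data's periodicity on the full period lattice (the carrier's `IsPeriodic`, one-direction forms read
off), the datum `e^{iηA}` and the competitor `e^{iλ}` periodic (`B8Thm2TorusSupplier.mgauge_periodic`, `B8Thm2TorusServerPer.gaugeExp_per`), and each
competitor's Landau multiplier replaced by its LEVEL-PERIODIC representative (`B8Thm2TorusServerPer.exists_levelPeriodic_multiplier`: the Landau letter's left side
`Δ↾Ω₀ D*(1∕iη) log (e^{iηA})^{(e^{iλ})⁻¹}` is periodic; `Q′ᵀ` is block-local and translation covariant); `Lⁿ ∣ p j` for `n ≤ k` from `Lᵏ ∣ p j`.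

HONEST SCOPE.  Assembly over landed modules; [4]'s letters (with their laws at periodic arguments) are HYPOTHESES at every member (N06 content at nested members;
nothing of [4] Thms 3.1–3.3, of Sect. E or of the contraction is proved here beyond composition); constants are the lineage's, sufficient only; `c₂, c₃` depend
on `d, L, B₁` and the displayed letters' constants.  The BANKED transfer `B8Prop5LandauDataZdPer.prop5Unique_per_of_zd` (uniqueness on `ℤᵈ` ⇒ among periodic
parameters) is NOT used: this file is torus-native (periodic letters in, periodic competitors out).  Count-neutral; N05 NOT discharged; one finite `T⁴` programme
at fixed `ε`; nothing continuum ∕ ℝ⁴ ∕ OS ∕ mass-gap ∕ Clay — the Yang–Mills mass gap is NOT proved.  No `sorry`, no `def`, no `… : Prop` fact, no `instance`,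
no `notation`.

RELATED IN THE TREE, NOT DUPLICATED: `B8Prop5UniqueZdLan` (dag-n05-d; the `ℤᵈ` template, its §1 `hwit_unitary_of_hyp169` USED), `B8Prop5LandauDataZdPer` (dag-n05-c;
the member, USED), `B8Prop5UniqSectEWPer` ∕ `B8Thm2TorusServerPer` (t2s-1; USED), `B8SockP5uEBodyNestedPer` ∕ `B8SockSP5uNestedPer` (this seat; the E-currency
twins U1–U3 of the same request).
-/

noncomputable section

open NormedSpace
open scoped BigOperators

namespace Literature.MathematicalPhysics.QuantumFieldTheory.Balaban1983to89.B8Prop5UniqueZdLanPer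

open Complex (I)
open B7Prop1Explicit B7Prop2Explicit B7Prop1Local B7Eq92Concrete
open B7Prop2Explicit (C0 c2')
open B7Prop10General (C6 C4G)
open B7Prop9Flat (C5')
open B7Eq78Linearization (conjR zdBlocking QprimeIter)
open B7Eq167Flat (InLambda)
open B8Ineq132 (covDerivFwd covDeriv InAk BondTouches norm_conjR)
open B8Eq119TwistedAxial (Restr129 bgT)
open B8Eq184Proof (gaugeExp cfgExp)
open B8Eq182Proof (gAd)
open B8Eq188Proof (frakF3)
open B8Eq140Level (SideTouches sideTouches_of_bondTouches)
open B8Ineq130 (tlo thi)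
open B8Eq138LandauZd (IsLandau138W covDivB covLap QT logCfg)
open B8Ineq125Concrete (C2p)
open B8Eq1117Concrete (XSpace)
open B8Eq178Averages (Cond168 Cond169)
open B8Prop5ContractionKLevel (Bd2 Mc Kc)
open B8LambdaSpaceKLevel (wt wt_nonneg wt_pos)
open B8Prop5GaugeParamKLevel (norm_covDeriv_eq)
open B8Prop5KLevelLetters (covDivB_logCfg_gaugeFixed)
open B8Thm4AtLandau138 (pdevOn_tower_lt_of_inAk)
open B8SockP5uEWindows (uniqWindows_of_guard)
open B8Prop5LandauDataZd (Cond7374 ZdLanIdx zdLan norm_lt_of_lamNorm_lt)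
open B8Prop5LandauDataZdPer (zdLanPer)
open B8Prop5WitnessOfDatum (hwit_unitary_of_datum restr129_of_hyp169)
open B8Prop5ExistsZdLan (hA_of_cond169 bd2_covDivB_of_cond169)
open B8Prop5UniqueZdLan (hwit_unitary_of_hyp169)
open B8Prop5UniqSectEWPer (hFP_unique_of_sectE_local_wb_per)
open B8Prop5NeumannPeriodic (covDivB_per)
open B8Thm2TorusSupplier (mgauge_periodic)
open B8Thm2TorusLettersPerConv (covLap_per)
open B8Thm2TorusServerPer (exists_levelPeriodic_multiplier gaugeExp_per)
open T4TermwiseTorus (IsPeriodic)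

-- `Site` alone could resolve to the torus sites of `Setup.lean`; re-export the `ℤ^d` sites of `B7Prop1Explicit`.
export B7Prop1Explicit (Site)

variable {d : ℕ}

/-! ## Proposition 5's uniqueness clause (1.109) AS PRINTED at `zdLanPer`, over any index ∕ period maps into the `Ω 0 = T_η` members -/

section Main

variable {𝔸 : Type} [CStarAlgebra 𝔸] [Nontrivial 𝔸]

/-- ★★★ **PROPOSITION 5, UNIQUENESS CLAUSE (1.109) AS PRINTED, ON THE TORUS — `B8.Prop5Unique (fun j => zdLanPer L B₁ (ι j) (p j))` MODULO [4]'s UNIQUENESS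
LETTERS WITH THEIR LAWS AT PERIODIC ARGUMENTS** (the periodic twin of `B8Prop5UniqueZdLan.prop5Unique_zdLan_of_lettersUB`).  For `d, L ≥ 2`, `B₁ ≥ 0`, letters'
constants `B₀′_H > 0`, `B₂′, B_G, B_R ≥ 0`, regularity threshold `c_L > 0`, an index map `ι : J → ZdLanIdx d 𝔸` and a period map `p : J → ℕ` into members
with `Ω 0 = ℤᵈ` (print's `Ω₀ = T_η` on `ηℤᵈ`), antitone `{Ω_j}`, towers `Bʲ(Λ_j) ⊂ Ω_j`, `p j`-PERIODIC background `U₀`, `Lᵏ ∣ p j` and constraint sets `Λ_n`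
invariant under the period shifts: IF at every `ι j`, for every regularity `α₀ ≤ c_L` with `U₀ ∈ 𝔄_k({Ω_j}, α₀)`, there are `ℂ`-linear letters `g = G′`, `Δ`,
`q = Q′`, `qs = Q′ᵀ`, `Aw = 𝔄`, `c = C`, `H′` at `(k, Λ, U₀)` with — (U1) the left-inverse law of `G′` for `p j`-PERIODIC BOUNDED inputs, (U2) the left inverse
of `C` in range form at LEVEL-PERIODIC multipliers, the readings of `Δ`, `Q′ᵀ`, `Q′` (zero off the structure), (P) `G′` periodic-valued, `𝔄` level-periodic-valued,
`H′` periodicity-preserving, (1.92) for `H′`, (1.91) `Q′H′ = I` at LEVEL-PERIODIC families, (1.101) for `G′`, (1.98) for `R` — THEN print's uniqueness clause holds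
on the periodic family: there are `c₂, c₃ > 0` such that at every member, for every `α₀ + α₁ ≤ c₂` and every PERIODIC datum `(u₁, A)` with (1.33), (1.69),
(1.68), (1.73)–(1.74), two PERIODIC parameters `λ₁, λ₂` solving (1.107) with `|λᵢ|, |Dλᵢ|₍₋₁₎ < c₃` COINCIDE (`c₂ = min(c_P, c_L)`, `c₃ = c_u∕L`, `α₄, c_u, c_P`
of `B8SockP5uEWindows.uniqWindows_of_guard` at `B₀ = max(B₁, 2)∕(5dL)`).  PROOF = the `ℤᵈ` template's with the torus JOIN
`B8Prop5UniqSectEWPer.hFP_unique_of_sectE_local_wb_per`; each competitor's multiplier is made LEVEL-PERIODIC by `B8Thm2TorusServerPer.exists_levelPeriodic_multiplier`.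
[cite: Balaban1985RegularSpaces, Prop. 5 (1.109) p.94, p.89 (after (1.76)), (1.68)–(1.69) p.88, (1.102) p.93, (1.112)–(1.121) pp.95–97, p.77 («Ω_j ⊂ T_η»), §3 p.98; Balaban1985Averaging, Prop. 10 p.50, (4) p.18;
Balaban1985BackgroundPropagators, Thm 3.1 p.397, (3.25) p.394, Thms 3.2–3.3 pp.397–398] -/
theorem prop5Unique_zdLanPer_of_lettersAtPerNested (hd2 : 2 ≤ d) {L : ℕ} (hL : 2 ≤ L) {B₁ B₀'H B₂' BG BR cL : ℝ} (hB₁ : 0 ≤ B₁)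
    (hB₀'H : 0 < B₀'H) (hB₂' : 0 ≤ B₂') (hBG : 0 ≤ BG) (hBR : 0 ≤ BR) (hcL : 0 < cL)
    {J : Type} (ι : J → ZdLanIdx d 𝔸) (p : J → ℕ) (hΩ0 : ∀ j, (ι j).Ω 0 = Set.univ) (hΩ : ∀ j n, (ι j).Ω (n + 1) ⊆ (ι j).Ω n)
    (htower : ∀ j, ∀ n, n ≤ (ι j).k → ∀ y ∈ (ι j).Λ n, ∀ x, InBox (tlo L y n) (thi L y n) x → x ∈ (ι j).Ω n)
    -- the torus at every member (§3 p. 98; [3] (4) p. 18): the fixed background is `p j`-periodic, `Lᵏ ∣ p j`, every `Λ_n` is invariant under the period shifts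
    (hU₀per : ∀ j, IsPeriodic (p j) (ι j).U₀)
    (hPdiv : ∀ j, ((L : ℤ) ^ (ι j).k ∣ (p j : ℤ)))
    (hΛ : ∀ j, ∀ n, n ≤ (ι j).k → ∀ (y : Site d) (i : Fin d), y + ((p j : ℤ) / (L : ℤ) ^ n) • e i ∈ (ι j).Λ n ↔ y ∈ (ι j).Λ n)
    -- [4]'s uniqueness letters at every member, (U1)∕(U2)∕(1.91) AT PERIODIC ARGUMENTS, (P) periodicity-preservation laws
    (SLetUBper : ∀ j : J, ∀ α₀ : ℝ, 0 < α₀ → α₀ ≤ cL → InAk L (ι j).k (ι j).η α₀ (ι j).Ω (ι j).U₀ →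
      ∃ (g Δ : (Site d → 𝔸) →ₗ[ℂ] (Site d → 𝔸)) (q : (Site d → 𝔸) →ₗ[ℂ] (ℕ → Site d → 𝔸)) (qs : (ℕ → Site d → 𝔸) →ₗ[ℂ] (Site d → 𝔸))
        (Aw c : (ℕ → Site d → 𝔸) →ₗ[ℂ] (ℕ → Site d → 𝔸)) (H' : XSpace d (ι j).k 𝔸 →ₗ[ℂ] (Site d → 𝔸)),
        (∀ x : Site d → 𝔸, (∀ (z : Site d) (i : Fin d), x (z + (p j : ℤ) • e i) = x z) → (∃ C : ℝ, ∀ y, ‖x y‖ ≤ C) →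
          g (Δ x + qs (Aw (q x))) = x) ∧
        (∀ φ : ℕ → Site d → 𝔸, (∀ n, n ≤ (ι j).k → ∀ (y : Site d) (i : Fin d), φ n (y + ((p j : ℤ) / (L : ℤ) ^ n) • e i) = φ n y) →
          qs (c (q (g (g (qs φ))))) = qs φ) ∧
        (∀ (f : Site d → 𝔸), ∀ x ∈ (ι j).Ω 0, Δ f x = covLap (ι j).η (ι j).U₀ (((ι j).Ω 0).indicator f) x) ∧
        (∀ (μ : ℕ → Site d → 𝔸), ∀ x ∈ (ι j).Ω 0, qs μ x = QT L (ι j).k (ι j).Λ (ι j).U₀ μ x) ∧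
        (∀ (f : Site d → 𝔸) (n : ℕ), n ≤ (ι j).k → ∀ y ∈ (ι j).Λ n, q f n y = QprimeIter (zdBlocking d L) (bgT L (ι j).U₀) n f y) ∧
        (∀ (f : Site d → 𝔸) (n : ℕ) (y : Site d), ¬ (n ≤ (ι j).k ∧ y ∈ (ι j).Λ n) → q f n y = 0) ∧
        (∀ (f : Site d → 𝔸) (z : Site d) (i : Fin d), g f (z + (p j : ℤ) • e i) = g f z) ∧
        (∀ μ : ℕ → Site d → 𝔸, ∀ n, n ≤ (ι j).k → ∀ (y : Site d) (i : Fin d), Aw μ n (y + ((p j : ℤ) / (L : ℤ) ^ n) • e i) = Aw μ n y) ∧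
        (∀ (X : XSpace d (ι j).k 𝔸) (x : Site d), ‖H' X x‖ ≤ B₀'H * ‖X‖) ∧
        (∀ n, n ≤ (ι j).k → ∀ (X : XSpace d (ι j).k 𝔸), ∀ b ∈ {b : Site d × Fin d | SideTouches ((ι j).Ω n) b.1 b.2},
          wt L (ι j).η n * ‖covDerivFwd (ι j).η (ι j).U₀ b.2 (H' X) b.1‖ ≤ B₀'H * ‖X‖) ∧
        (∀ X : XSpace d (ι j).k 𝔸, Bd2 L (ι j).η (ι j).k (ι j).Ω (covLap (ι j).η (ι j).U₀ (H' X)) (B₂' * ‖X‖)) ∧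
        (∀ X : XSpace d (ι j).k 𝔸, (∀ (q : Fin ((ι j).k + 1) × Site d) (i : Fin d), X (q.1, q.2 + ((p j : ℤ) / (L : ℤ) ^ (q.1 : ℕ)) • e i) = X q) →
          ∀ (z : Site d) (i : Fin d), H' X (z + (p j : ℤ) • e i) = H' X z) ∧
        (∀ (Y : XSpace d (ι j).k 𝔸), (∀ (q : Fin ((ι j).k + 1) × Site d) (i : Fin d), Y (q.1, q.2 + ((p j : ℤ) / (L : ℤ) ^ (q.1 : ℕ)) • e i) = Y q) →
          ∀ (n : ℕ) (hn : n ≤ (ι j).k) (y : Site d), y ∈ (ι j).Λ n →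
          QprimeIter (zdBlocking d L) (bgT L (ι j).U₀) n (H' Y) y = Y (⟨n, Nat.lt_succ_of_le hn⟩, y)) ∧
        (∀ (f : Site d → 𝔸) (r : ℝ), 0 ≤ r → Bd2 L (ι j).η (ι j).k (ι j).Ω f r →
          (∀ x, ‖g f x‖ ≤ BG * r) ∧ ∀ n, n ≤ (ι j).k → ∀ b ∈ {b : Site d × Fin d | SideTouches ((ι j).Ω n) b.1 b.2},
            wt L (ι j).η n * ‖covDerivFwd (ι j).η (ι j).U₀ b.2 (g f) b.1‖ ≤ BG * r) ∧
        (∀ (f : Site d → 𝔸) (r : ℝ), 0 ≤ r → Bd2 L (ι j).η (ι j).k (ι j).Ω f r →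
          Bd2 L (ι j).η (ι j).k (ι j).Ω (f - g (qs (c (q (g f))))) (BR * r))) :
    B8.Prop5Unique (fun j : J => zdLanPer L B₁ (ι j) (p j)) := by
  have hd1 : 1 ≤ d := le_trans (by norm_num) hd2
  have hL1 : 1 ≤ L := le_trans (by norm_num) hL
  have hLr : (1 : ℝ) ≤ L := by exact_mod_cast hL1
  have hL0 : (0 : ℝ) < L := by positivity
  have hdr : (1 : ℝ) ≤ d := by exact_mod_cast hd1
  haveI : Nontrivial (Fin d) := Fin.nontrivial_iff_two_le.mpr hd2
  -- the windows of n04-b at B₀ := max(B₁, 2)/(5dL): ONE contraction radius α₄, ONE socket radius c_u, ONE threshold c_P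
  have hBp2 : (2 : ℝ) ≤ max B₁ 2 := le_max_right _ _
  have hBp0 : (0 : ℝ) < max B₁ 2 := by linarith
  have h5 : (0 : ℝ) < 5 * (d : ℝ) * L := by positivity
  have hB₀ : (0 : ℝ) < max B₁ 2 / (5 * (d : ℝ) * L) := div_pos hBp0 h5
  have hBeq : 5 * (d : ℝ) * L * (max B₁ 2 / (5 * (d : ℝ) * L)) = max B₁ 2 := by field_simp
  have hB : (2 : ℝ) ≤ 5 * (d : ℝ) * L * (max B₁ 2 / (5 * (d : ℝ) * L)) := by rw [hBeq]; exact hBp2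
  obtain ⟨α₄, cu, cP, hα₄, hcu, hcP, hwin⟩ := uniqWindows_of_guard (cB9 := 1) hd1 hL1 hB₀ hB hB₀'H hB₂' hBG hBR one_pos
  unfold B8.Prop5Unique
  refine ⟨min cP cL, cu / L, lt_min hcP hcL, div_pos hcu hL0, ?_⟩
  intro j α₀ α₁ hα₀ hα₁ hs pp hpp ll₁ ll₂ hS₁ hS₂ hn₁ hn₂
  -- the periodic datum and the two periodic parameters, read at the underlying fields (`zdLanPer`'s fields ARE `zdLan`'s there)
  obtain ⟨p', hpu, hpA⟩ := pp
  obtain ⟨l₁, hl₁P⟩ := ll₁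
  obtain ⟨l₂, hl₂P⟩ := ll₂
  have hp : (zdLan L B₁ (ι j)).Hyp169 α₀ α₁ p' := hpp
  -- THE MEMBER
  have hη := (ι j).hη
  have hk := (ι j).hk
  have hU₀ := (ι j).hU₀
  have huniv : ∀ x, x ∈ (ι j).Ω 0 := fun x => by rw [hΩ0 j]; exact Set.mem_univ x
  have hsum : 0 < α₀ + α₁ := add_pos hα₀ hα₁
  -- the torus data in the engines' one-direction currency `z + P • e i` (`P := p j`), and `Lⁿ ∣ P` for `n ≤ k`
  have hU₀per' : ∀ (z : Site d) (i : Fin d), (ι j).U₀ (z + (p j : ℤ) • e i) = (ι j).U₀ z := fun z i => hU₀per j z (e i)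
  have hAper' : ∀ (z : Site d) (i : Fin d), p'.1.2 (z + (p j : ℤ) • e i) = p'.1.2 z := fun z i => hpA z (e i)
  have hu₁per' : ∀ (z : Site d) (i : Fin d), p'.1.1 (z + (p j : ℤ) • e i) = p'.1.1 z := fun z i => hpu z (e i)
  have hl₁P' : ∀ (z : Site d) (i : Fin d), l₁.1 (z + (p j : ℤ) • e i) = l₁.1 z := fun z i => hl₁P z (e i)
  have hl₂P' : ∀ (z : Site d) (i : Fin d), l₂.1 (z + (p j : ℤ) • e i) = l₂.1 z := fun z i => hl₂P z (e i)
  have hdivP : ∀ n, n ≤ (ι j).k → ((L : ℤ) ^ n ∣ (p j : ℤ)) := fun n hn => (pow_dvd_pow (L : ℤ) hn).trans (hPdiv j)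
  have hΛP := hΛ j
  -- the scales: c⋆ := max(B₁,2)(α₀+α₁), c_B = c_A := L·c⋆, c_DA := dL²·c⋆, α₃ := 40d·c_B
  have hcs_eq : max B₁ 2 * (α₀ + α₁) = 5 * (d : ℝ) * L * (max B₁ 2 / (5 * (d : ℝ) * L)) * (α₀ + α₁) := by rw [hBeq]
  obtain ⟨-, -, -, -, -, -, hα3, hα4, -, -, -, hα₃', hs₁, hs₂, hs₃, hs₄, hs₅, hs₆, hs₇, hsm, hprod8, hcA', ha₁', hb₁', hθ, h103, h106, hlE, hcuw⟩ :=
    hwin α₀ α₁ hα₀ hα₁ (hs.trans (min_le_left _ _)) (max B₁ 2 * (α₀ + α₁)) _ _ _ _ _ _ hcs_eq rfl rfl rfl rfl rfl rfl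
  have hcs0 : 0 ≤ max B₁ 2 * (α₀ + α₁) := by positivity
  have hcB0 : 0 ≤ (L : ℝ) * (max B₁ 2 * (α₀ + α₁)) := by positivity
  have hcDA0 : 0 ≤ (d : ℝ) * (L : ℝ) ^ 2 * (max B₁ 2 * (α₀ + α₁)) := by positivity
  have hα₃0 : (0 : ℝ) ≤ 40 * d * ((L : ℝ) * (max B₁ 2 * (α₀ + α₁))) := by positivity
  have hC2 : 0 ≤ C2p d := B8Ineq125Concrete.C2p_nonneg d
  have hhE : 0 ≤ B₀'H * (C2p d * (40 * d * ((L : ℝ) * (max B₁ 2 * (α₀ + α₁))) + α₄) * α₄) := by positivity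
  -- the datum's constant `B₁(α₀+α₁)` lies below the scale `c⋆`; `c⋆ ≤ c_B ≤ 1/13`
  have hc1 : B₁ * (α₀ + α₁) ≤ max B₁ 2 * (α₀ + α₁) := mul_le_mul_of_nonneg_right (le_max_left _ _) hsum.le
  have hc10 : 0 ≤ B₁ * (α₀ + α₁) := by positivity
  have hcsB : max B₁ 2 * (α₀ + α₁) ≤ (L : ℝ) * (max B₁ 2 * (α₀ + α₁)) := le_mul_of_one_le_left hcs0 hLr
  have hcs13 : max B₁ 2 * (α₀ + α₁) ≤ 1 / 13 := hcsB.trans hcA'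
  -- the radius: c_u ≤ ¼α₄, 1/12, 1/70; c₃ = c_u/L ≤ c_u
  have hcu4 : cu ≤ α₄ / 4 := by linarith only [hcuw, hhE]
  have hcu12 : cu ≤ 1 / 12 := by linarith only [hcu4, ha₁', hhE]
  have hcu70 : cu ≤ 1 / 70 := by linarith only [hcu4, hb₁', hhE]
  have hcuL : cu / L ≤ cu := div_le_self hcu.le hLr
  -- THE DATUM `(u₁, A)`: (1.33), (1.69); (1.68) ⇒ (1.29); (1.73)/(1.74) ⇒ the Λ_j-witnesses at class constant α₃ = 40d·c_B
  have hp' := hp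
  obtain ⟨h33, h69, -, -⟩ := hp'
  have h33' : ∀ n, n ≤ (ι j).k → ∀ y ∈ (ι j).Λ n, pdevOn (tlo L y n) (thi L y n) (ι j).U₀ < α₀ * (((L : ℝ) ^ n)⁻¹) ^ 2 :=
    fun n hn y hy => pdevOn_tower_lt_of_inAk hL1 hα₀ h33 hn (htower j n hn y hy)
  have h69' : Cond169 L (ι j).k (ι j).η (ι j).Ω (ι j).U₀ p'.1.2 (max B₁ 2 * (α₀ + α₁)) :=
    B8Eq178Averages.cond169_mono hη.le hc1 h69
  have hAd : ∀ n, n ≤ (ι j).k → ∀ x ∈ (ι j).Ω n, ∀ μ : Fin d,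
      wt L (ι j).η n * ‖p'.1.2 x μ‖ ≤ (L : ℝ) * (max B₁ 2 * (α₀ + α₁)) ∧
        wt L (ι j).η n * ‖conjR ((ι j).U₀ (x - e μ) μ)⁻¹ (p'.1.2 (x - e μ) μ)‖ ≤ (L : ℝ) * (max B₁ 2 * (α₀ + α₁)) :=
    hA_of_cond169 hL1 hη hk (hΩ j) hU₀ hcs0 h69'
  have hDA : Bd2 L (ι j).η (ι j).k (ι j).Ω (fun y => covDivB (ι j).η (ι j).U₀ p'.1.2 y) ((d : ℝ) * (L : ℝ) ^ 2 * (max B₁ 2 * (α₀ + α₁))) :=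
    bd2_covDivB_of_cond169 hL1 hη hk (hΩ j) hU₀ hcs0 h69'
  have h129 : Restr129 L (ι j).k (ι j).Λ (ι j).U₀ p'.1.1 := restr129_of_hyp169 hL1 B₁ (ι j) hp
  have hwit : ∀ n, n ≤ (ι j).k → ∀ y ∈ (ι j).Λ n, ∃ ut : Site d → 𝔸ˣ, (∀ x, ut x ∈ unitaryUnits 𝔸) ∧
      InLambda L (clampCfg (tlo L y n) (thi L y n) (ι j).U₀) ut n (40 * d * ((L : ℝ) * (max B₁ 2 * (α₀ + α₁)))) (((L : ℝ) ^ n)⁻¹) ∧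
      ∀ x : Site d, tlo L y n ≤ x → x ≤ thi L y n → p'.1.1 x = ut x := by
    have hd0 : (0 : ℝ) ≤ d := by positivity
    have hdt : 0 ≤ (d : ℝ) * (max B₁ 2 * (α₀ + α₁)) := mul_nonneg hd0 hcs0
    have hdLt : 0 ≤ (d : ℝ) * ((L : ℝ) * (max B₁ 2 * (α₀ + α₁))) := mul_nonneg hd0 hcB0
    have ha : 16 * (d : ℝ) * B₁ * (α₀ + α₁) ≤ 40 * d * ((L : ℝ) * (max B₁ 2 * (α₀ + α₁))) :=
      calc 16 * (d : ℝ) * B₁ * (α₀ + α₁) = 16 * d * (B₁ * (α₀ + α₁)) := by ring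
        _ ≤ 16 * d * (max B₁ 2 * (α₀ + α₁)) := mul_le_mul_of_nonneg_left hc1 (by positivity)
        _ ≤ 40 * d * (max B₁ 2 * (α₀ + α₁)) := by linarith only [hdt]
        _ ≤ 40 * d * ((L : ℝ) * (max B₁ 2 * (α₀ + α₁))) := mul_le_mul_of_nonneg_left hcsB (by positivity)
    have hLb : (L : ℝ) * (4 * d * B₁ * (α₀ + α₁)) ≤ 40 * d * ((L : ℝ) * (max B₁ 2 * (α₀ + α₁))) := by
      have h2 : (L : ℝ) * (B₁ * (α₀ + α₁)) ≤ (L : ℝ) * (max B₁ 2 * (α₀ + α₁)) := mul_le_mul_of_nonneg_left hc1 hL0.le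
      calc (L : ℝ) * (4 * d * B₁ * (α₀ + α₁)) = 4 * d * ((L : ℝ) * (B₁ * (α₀ + α₁))) := by ring
        _ ≤ 4 * d * ((L : ℝ) * (max B₁ 2 * (α₀ + α₁))) := mul_le_mul_of_nonneg_left h2 (by positivity)
        _ ≤ 40 * d * ((L : ℝ) * (max B₁ 2 * (α₀ + α₁))) := by linarith only [hdLt]
    exact hwit_unitary_of_hyp169 hL1 hB₁ (ι j) hsum.le ha hLb hp
  -- THE LETTERS at (α₀, U₀); their `SideTouches`-laws restrict to the bonds touching `Ω_j`
  have hα₀L : α₀ ≤ cL := by linarith only [hs, min_le_right cP cL, hα₁]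
  obtain ⟨g, Δ, q, qs, Aw, c, H', g_leftB, c_left', hΔ, hqs, hq, hq0, hGper, hAw_per, hH0, hH1, hH2, hHper, hQH, hG, hRbd⟩ :=
    SLetUBper j α₀ hα₀ hα₀L h33
  have hbs : ∀ {S : Set (Site d)} {x : Site d} {μ : Fin d}, BondTouches S x μ → SideTouches S x μ := by
    intro S x μ hb
    obtain ⟨κ, hκ⟩ := exists_ne μ
    exact sideTouches_of_bondTouches hκ hb
  have hH1' : ∀ n, n ≤ (ι j).k → ∀ (X : XSpace d (ι j).k 𝔸), ∀ b ∈ {b : Site d × Fin d | BondTouches ((ι j).Ω n) b.1 b.2},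
      wt L (ι j).η n * ‖covDerivFwd (ι j).η (ι j).U₀ b.2 (H' X) b.1‖ ≤ B₀'H * ‖X‖ :=
    fun n hn X b hb => hH1 n hn X b (hbs hb)
  have hG' : ∀ (f : Site d → 𝔸) (r : ℝ), 0 ≤ r → Bd2 L (ι j).η (ι j).k (ι j).Ω f r →
      (∀ x, ‖g f x‖ ≤ BG * r) ∧ ∀ n, n ≤ (ι j).k → ∀ b ∈ {b : Site d × Fin d | BondTouches ((ι j).Ω n) b.1 b.2},
        wt L (ι j).η n * ‖covDerivFwd (ι j).η (ι j).U₀ b.2 (g f) b.1‖ ≤ BG * r :=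
    fun f r hr hf => ⟨(hG f r hr hf).1, fun n hn b hb => (hG f r hr hf).2 n hn b (hbs hb)⟩
  -- the bond classes `Eb j := {b ∣ b touches Ω_j}`
  have hEbΩ : ∀ n, n ≤ (ι j).k → ∀ x ∈ (ι j).Ω n, ∀ μ : Fin d, (x, μ) ∈ {b : Site d × Fin d | BondTouches ((ι j).Ω n) b.1 b.2} ∧
      (x - e μ, μ) ∈ {b : Site d × Fin d | BondTouches ((ι j).Ω n) b.1 b.2} :=
    fun n _ x hx μ => ⟨Or.inl hx, Or.inr (by show x - e μ + e μ ∈ (ι j).Ω n; rw [sub_add_cancel]; exact hx)⟩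
  have hEbT : ∀ n, n ≤ (ι j).k → ∀ y ∈ (ι j).Λ n, ∀ (x : Site d) (κ : Fin d), InBox (tlo L y n) (thi L y n) x →
      InBox (tlo L y n) (thi L y n) (x + e κ) → (x, κ) ∈ {b : Site d × Fin d | BondTouches ((ι j).Ω n) b.1 b.2} :=
    fun n hn y hy x κ hx _ => Or.inl (htower j n hn y hy x hx)
  -- `Ω_k ⊂ Ω_{k−1}`
  have hΩk : (ι j).Ω (ι j).k ⊆ (ι j).Ω ((ι j).k - 1) := by
    have h := hΩ j ((ι j).k - 1)
    rwa [Nat.sub_add_cancel hk] at h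
  -- EACH PERIODIC SOLUTION: the (1.109)-ball ⇒ the engine's radius c_u at k levels; (1.107)₁ ⇒ the multiplier clause by the D*-identity, with a
  -- LEVEL-PERIODIC multiplier (the Landau letter's left side is periodic: `U₀`, `A`, `λ` are); (1.107)₂ verbatim
  have hsol : ∀ l : (zdLan L B₁ (ι j)).Lam, (∀ (z : Site d) (i : Fin d), l.1 (z + (p j : ℤ) • e i) = l.1 z) →
      (zdLan L B₁ (ι j)).Solves p' l → (zdLan L B₁ (ι j)).lamNorm l < cu / L →
      (∀ x, ‖l.1 x‖ ≤ cu) ∧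
      (∀ n, n ≤ (ι j).k → ∀ b ∈ {b : Site d × Fin d | BondTouches ((ι j).Ω n) b.1 b.2},
        wt L (ι j).η n * ‖covDerivFwd (ι j).η (ι j).U₀ b.2 l.1 b.1‖ ≤ cu) ∧
      (∃ μ : ℕ → Site d → 𝔸, (∀ n, n ≤ (ι j).k → ∀ (y : Site d) (i : Fin d), μ n (y + ((p j : ℤ) / (L : ℤ) ^ n) • e i) = μ n y) ∧
        ∀ x ∈ (ι j).Ω 0,
        covLap (ι j).η (ι j).U₀ (((ι j).Ω 0).indicator fun y => covDivB (ι j).η (ι j).U₀ p'.1.2 y + covLap (ι j).η (ι j).U₀ l.1 y +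
          ((conjR (gaugeExp l.1 y)⁻¹ (covDivB (ι j).η (ι j).U₀ p'.1.2 y) - covDivB (ι j).η (ι j).U₀ p'.1.2 y) +
            (gAd (covLap (ι j).η (ι j).U₀ l.1 y) (l.1 y) - covLap (ι j).η (ι j).U₀ l.1 y) +
              ∑ μ, frakF3 (ι j).η (ι j).U₀ l.1 p'.1.2 y μ)) x = QT L (ι j).k (ι j).Λ (ι j).U₀ μ x) ∧
      Restr129 L (ι j).k (ι j).Λ (ι j).U₀ (p'.1.1 * gaugeExp l.1) := by
    intro l hlP hS hn
    obtain ⟨hLan, hR⟩ := hS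
    -- the dictionary (1.109) ⇒ pointwise, levels n ≤ k − 1
    have hpt := fun (n : ℕ) (hn' : n ≤ (ι j).k - 1) => norm_lt_of_lamNorm_lt L B₁ (ι j) hL1 l hn hn'
    have hl : ∀ x, ‖l.1 x‖ ≤ cu := fun x => ((hpt 0 (Nat.zero_le _)).1 x (huniv x)).le.trans hcuL
    have hDn : ∀ n, n ≤ (ι j).k - 1 → ∀ (x : Site d) (μ : Fin d), BondTouches ((ι j).Ω n) x μ →
        wt L (ι j).η n * ‖covDerivFwd (ι j).η (ι j).U₀ μ l.1 x‖ ≤ cu / L := fun n hn' x μ hb => by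
      unfold wt; exact ((hpt n hn').2 x μ hb).le
    have hD : ∀ n, n ≤ (ι j).k → ∀ b ∈ {b : Site d × Fin d | BondTouches ((ι j).Ω n) b.1 b.2},
        wt L (ι j).η n * ‖covDerivFwd (ι j).η (ι j).U₀ b.2 l.1 b.1‖ ≤ cu := by
      intro n hn' b hb
      rcases Nat.lt_or_ge n (ι j).k with hlt | hge
      · exact (hDn n (by omega) b.1 b.2 hb).trans hcuL
      · obtain rfl : n = (ι j).k := le_antisymm hn' hge
        have hb' : BondTouches ((ι j).Ω ((ι j).k - 1)) b.1 b.2 := hb.imp (fun h => hΩk h) (fun h => hΩk h)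
        have h := hDn ((ι j).k - 1) le_rfl b.1 b.2 hb'
        have hw : wt L (ι j).η (ι j).k = L * wt L (ι j).η ((ι j).k - 1) := by
          unfold wt
          rw [← mul_assoc, ← pow_succ', Nat.sub_add_cancel hk]
        have hwm : 0 ≤ wt L (ι j).η ((ι j).k - 1) := wt_nonneg L hη.le _
        rw [hw, mul_assoc]
        calc (L : ℝ) * (wt L (ι j).η ((ι j).k - 1) * ‖covDerivFwd (ι j).η (ι j).U₀ b.2 l.1 b.1‖) ≤ L * (cu / L) :=
              mul_le_mul_of_nonneg_left h hL0.le
          _ = cu := by field_simp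
    -- the multiplier clause from the Landau condition of record (the D*-identity read backwards, on Ω₀ = ℤᵈ), with a LEVEL-PERIODIC multiplier
    have hk0 : 0 < (ι j).k := hk
    have hmult : ∃ μ : ℕ → Site d → 𝔸, (∀ n, n ≤ (ι j).k → ∀ (y : Site d) (i : Fin d), μ n (y + ((p j : ℤ) / (L : ℤ) ^ n) • e i) = μ n y) ∧
        ∀ x ∈ (ι j).Ω 0,
        covLap (ι j).η (ι j).U₀ (((ι j).Ω 0).indicator fun y => covDivB (ι j).η (ι j).U₀ p'.1.2 y + covLap (ι j).η (ι j).U₀ l.1 y +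
          ((conjR (gaugeExp l.1 y)⁻¹ (covDivB (ι j).η (ι j).U₀ p'.1.2 y) - covDivB (ι j).η (ι j).U₀ p'.1.2 y) +
            (gAd (covLap (ι j).η (ι j).U₀ l.1 y) (l.1 y) - covLap (ι j).η (ι j).U₀ l.1 y) +
              ∑ μ, frakF3 (ι j).η (ι j).U₀ l.1 p'.1.2 y μ)) x = QT L (ι j).k (ι j).Λ (ι j).U₀ μ x := by
      obtain ⟨μ, hμ⟩ := hLan
      -- the Landau letter's left side is periodic: a level-periodic representative of the multiplier
      set W : Site d → Fin d → 𝔸ˣ := mgauge (ι j).U₀ (gaugeExp l.1)⁻¹ (cfgExp (ι j).η p'.1.2) with hWdef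
      have hWP : ∀ (z : Site d) (i : Fin d), W (z + (p j : ℤ) • e i) = W z := fun z i => funext fun κ =>
        mgauge_periodic (p := (p j : ℤ) • e i) (fun x κ => by rw [hU₀per' x i])
          (fun x κ => by show cfgExp (ι j).η p'.1.2 (x + (p j : ℤ) • e i) κ = cfgExp (ι j).η p'.1.2 x κ; unfold cfgExp; rw [hAper' x i])
          (fun x => by rw [Pi.inv_apply, Pi.inv_apply, gaugeExp_per hlP x i]) z κ
      have hlogP : ∀ (z : Site d) (i : Fin d), logCfg (ι j).η W (z + (p j : ℤ) • e i) = logCfg (ι j).η W z := fun z i => funext fun κ => by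
        show logCfg (ι j).η W (z + (p j : ℤ) • e i) κ = logCfg (ι j).η W z κ
        unfold logCfg; rw [hWP z i]
      have hFP : ∀ (z : Site d) (i : Fin d),
          covLap (ι j).η (ι j).U₀ (((ι j).Ω 0).indicator (covDivB (ι j).η (ι j).U₀ (logCfg (ι j).η W))) (z + (p j : ℤ) • e i) =
            covLap (ι j).η (ι j).U₀ (((ι j).Ω 0).indicator (covDivB (ι j).η (ι j).U₀ (logCfg (ι j).η W))) z := by
        rw [hΩ0 j, Set.indicator_univ]
        exact covLap_per hU₀per' (covDivB_per hU₀per' hlogP)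
      obtain ⟨μ', hμ'per, hμ'⟩ := exists_levelPeriodic_multiplier hL1 (ι j).k hdivP hΛP hU₀per' hFP (fun x => hμ x (huniv x))
      refine ⟨μ', hμ'per, fun x hx => ?_⟩
      have hind : (((ι j).Ω 0).indicator fun y => covDivB (ι j).η (ι j).U₀ p'.1.2 y + covLap (ι j).η (ι j).U₀ l.1 y +
          ((conjR (gaugeExp l.1 y)⁻¹ (covDivB (ι j).η (ι j).U₀ p'.1.2 y) - covDivB (ι j).η (ι j).U₀ p'.1.2 y) +
            (gAd (covLap (ι j).η (ι j).U₀ l.1 y) (l.1 y) - covLap (ι j).η (ι j).U₀ l.1 y) +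
              ∑ μ, frakF3 (ι j).η (ι j).U₀ l.1 p'.1.2 y μ)) =
          ((ι j).Ω 0).indicator (covDivB (ι j).η (ι j).U₀ (logCfg (ι j).η (mgauge (ι j).U₀ (gaugeExp l.1)⁻¹ (cfgExp (ι j).η p'.1.2)))) := by
        refine Set.indicator_congr fun y _ => ?_
        have hly : ‖l.1 y‖ ≤ 1 / 12 := (hl y).trans hcu12
        have h0 := hpt 0 (Nat.zero_le _)
        have hDy : ∀ ν : Fin d, (ι j).η * ‖covDerivFwd (ι j).η (ι j).U₀ ν l.1 y‖ ≤ 1 / 70 := fun ν => by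
          have h := (h0.2 y ν (Or.inl (huniv y))).le
          rw [pow_zero, one_mul] at h
          exact h.trans (hcuL.trans hcu70)
        have hay : ∀ ν : Fin d, (ι j).η * ‖covDeriv (ι j).η (ι j).U₀ ν l.1 y‖ ≤ 1 / 70 := fun ν => by
          rw [norm_covDeriv_eq hU₀]
          have h := (h0.2 (y - e ν) ν (Or.inl (huniv _))).le
          rw [pow_zero, one_mul] at h
          exact h.trans (hcuL.trans hcu70)
        have hYy : ∀ ν : Fin d, (ι j).η * ‖conjR ((ι j).U₀ (y - e ν) ν)⁻¹ (p'.1.2 (y - e ν) ν)‖ ≤ 1 / 12 := fun ν => by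
          have hu : (((ι j).U₀ (y - e ν) ν)⁻¹ : 𝔸ˣ) ∈ U1 𝔸 := (U1 𝔸).inv_mem (unitaryUnits_le_U1 (hU₀ _ ν))
          rw [norm_conjR hu]
          have hA := ((h69' 0 hk0 (y - e ν) ν (Or.inl (huniv _))).1).le
          rw [pow_zero, one_mul] at hA
          calc (ι j).η * ‖p'.1.2 (y - e ν) ν‖ ≤ (ι j).η * (max B₁ 2 * (α₀ + α₁) * (ι j).η⁻¹) := mul_le_mul_of_nonneg_left hA hη.le
            _ = max B₁ 2 * (α₀ + α₁) := by field_simp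
            _ ≤ 1 / 12 := by linarith only [hcs13]
        exact (covDivB_logCfg_gaugeFixed hη (ι j).U₀ p'.1.2 hly hDy hay hYy).symm
      rw [hind]
      exact hμ' x
    exact ⟨hl, hD, hmult, hR⟩
  obtain ⟨hl₁, hD₁, hmult₁, hR₁⟩ := hsol l₁ hl₁P' hS₁ hn₁
  obtain ⟨hl₂, hD₂, hmult₂, hR₂⟩ := hsol l₂ hl₂P' hS₂ hn₂
  -- THE UNIQUENESS JOIN ON THE TORUS (`hFP_unique_of_sectE_local_wb_per`, BY NAME) at ρ := c_u, α₃ := 40d·c_B, c_A := c_B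
  have heq : l₁.1 = l₂.1 := hFP_unique_of_sectE_local_wb_per (Ω := (ι j).Ω) (Λs := (ι j).Λ)
    (Eb := fun n => {b : Site d × Fin d | BondTouches ((ι j).Ω n) b.1 b.2}) (u₁ := p'.1.1) (A := p'.1.2) hL hη hU₀ (p j : ℤ) (hΩ0 j) hEbΩ hEbT
    g Δ q qs Aw c g_leftB c_left' hΔ hqs hq hq0 hdivP hΛP hU₀per' hAper' hu₁per' hGper hAw_per H' hα₀ hα3 hα4 hα₃0 hα₄ hB₀'H hB₂' h33' hwit h129
    hH0 hH1' hH2 hHper hQH hα₃' hs₁ hs₂ hs₃ hs₄ hs₅ hs₆ hs₇ hsm hprod8 rfl rfl rfl rfl hBG hBR hcB0 hcA' hcDA0 ha₁' hb₁' hθ hlE hcuw hG' hRbd hDA hAd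
    h103 h106 hl₁P' hl₁ hD₁ hmult₁ hR₁ hl₂P' hl₂ hD₂ hmult₂ hR₂
  exact Subtype.ext (Subtype.ext heq)

end Main

#print axioms prop5Unique_zdLanPer_of_lettersAtPerNested

end Literature.MathematicalPhysics.QuantumFieldTheory.Balaban1983to89.B8Prop5UniqueZdLanPer

end
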